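import Mathlib
import HarnessLib
import Summits.NavierStokesRegularity.NavierStokesRegularity.Theorems.PoloidalWindowDoorLrcModEntireTwistingTHLocalDatum
import Summits.NavierStokesRegularity.NavierStokesRegularity.Theorems.PoloidalWindowDoorLrcModEntireTwistingTHSlab
import Summits.NavierStokesRegularity.NavierStokesRegularity.Theorems.PoloidalWindowDoorPoloidalWindowRigiditySparseEnergySourceFree

/-!
# Route `PoloidalWindowDoor`, crux `PoloidalWindowRigidity` (stmt-19708), line `sparse_energy` —
# on K-sparse profiles the local (TH)∩twisting datum is SOURCE-FREE (`A ≡ 0` on the window)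

Seat ns-poloidal-K2-p2 g8 (interim LEAD-of-record on 19708; file `--supports`).  The consumer form of rung R2: K2-p3's datum theorem
`…TwistingTHLocalDatum.exists_localTHDatum` (the `(μ, A, U ⊆ W, p₀)` of every (TH)∩twisting window of a class profile) is re-run
for a profile whose scale-invariant energy is bounded (`∫_{B_R(a)} |v(t₀)|² ≤ K R`, the conclusion of the line's stub S1
`stub_scaledEnergy`), with ONE MORE conclusion: the pressure datum vanishes on the window, `∀ p ∈ U, A(p.1, p.2 2) = 0`.
Proof: shrink `U` to a product neighbourhood, read `μ, A` as analytic on a box, globalise the scalar law E from the window to the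
horizontal slab of the box (`…TwistingTHSlab.eLaw_on_of_germ`, identity principle), and apply
`…SparseEnergySourceFree.pressureDatum_eq_zero` (plane means + time integration).

For the engines / kernel port: on K-sparse profiles, in the ORIGINAL frame every `a_j` letter is `0`; after the Galilean boost to the
rest frame `u(p₀) = 0` (p586459) the datum is the EXPLICIT `A′ = c₂(∂ₜμ − ∂_z²μ) + (c₂²/2)∂_zμ` with the single scalar `c₂ = v₂(p₀)` —
no free function of `(t,z)` remains in E.

WHAT THIS IS NOT: not a claim about Navier–Stokes regularity, not the crux, and conditional in use on the line's open stub S1 (the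
K-bound is a HYPOTHESIS here); bears_on LADDER-NS N0 via crux 19708 / item 20428.
-/

noncomputable section

-- the summit and its single sub-problem share the name (CONVENTIONS §1), as in every Theorems file
set_option linter.dupNamespace false

namespace Summit.NavierStokesRegularity.NavierStokesRegularity.Theorems.PoloidalWindowDoorPoloidalWindowRigiditySparseEnergySourceFreeDatum

open MeasureTheory Set Function Filter Topology Metric
open scoped RealInnerProductSpace InnerProductSpace Laplacian ENNReal
open Literature.Analysis Literature.Analysis.FluidPDE
open Summit.NavierStokesRegularity.NavierStokesRegularity.Theorems.LocalSineTubeDoorProfileAlignedWindowRigidityAncient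
open Summit.NavierStokesRegularity.NavierStokesRegularity.Theorems.PoloidalWindowDoorLrcModEntireTwistingTHLocalDatum
open Summit.NavierStokesRegularity.NavierStokesRegularity.Theorems.PoloidalWindowDoorLrcModEntireTwistingTHSlab
open Summit.NavierStokesRegularity.NavierStokesRegularity.Theorems.PoloidalWindowDoorPoloidalWindowRigiditySparseEnergySourceFree

variable {C : ℝ} {v : ℝ → EuclideanSpace ℝ (Fin 3) → EuclideanSpace ℝ (Fin 3)}

/-- **The source-free local (TH)∩twisting datum of a K-sparse profile.**  `exists_localTHDatum` with the bounded scale-invariant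
energy as an extra hypothesis and `A ≡ 0` on the window as an extra conclusion. [folklore] -/
theorem exists_localTHDatum_sourceFree (hrate : Literature.Analysis.FluidPDE.HasTypeITimeDecay C v)
    (hcont : ContinuousOn (Function.uncurry v) (Set.Iio (0 : ℝ) ×ˢ Set.univ))
    (hmild : ∀ s t : ℝ, s < t → t < 0 → ∀ x, v t x =
      Literature.Analysis.UnboundedOperators.heatExtension (v s) (t - s) x -
        Literature.Analysis.FluidPDE.oseenDuhamel 1 s v v t x)
    (hdiv : ∀ t < 0, Literature.Analysis.FluidPDE.VectorCalculus.IsDivFree (v t))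
    (hpol : ∀ s < 0, ∀ y, ⟪Literature.Analysis.FluidPDE.curl (v s) y, EuclideanSpace.single 2 1⟫_ℝ = 0)
    {K : ℝ} (hK0 : 0 ≤ K)
    (hK : ∀ t₀ : ℝ, t₀ < 0 → ∀ (a : EuclideanSpace ℝ (Fin 3)) (R : ℝ), 0 < R →
      (∫⁻ x in Metric.ball a R, ENNReal.ofReal (‖v t₀ x‖ ^ 2)) ≤ ENNReal.ofReal (K * R))
    {W : Set (ℝ × EuclideanSpace ℝ (Fin 3))} (hW : IsOpen W) (hWne : W.Nonempty) (hWs : W ⊆ Set.Iio (0 : ℝ) ×ˢ Set.univ)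
    (hnd : ∀ z ∈ W, Literature.Analysis.FluidPDE.curl (v z.1) z.2 ≠ 0 ∧
      (fderiv ℝ (v z.1) z.2 (EuclideanSpace.single 0 1) 2 ≠ 0 ∨ fderiv ℝ (v z.1) z.2 (EuclideanSpace.single 1 1) 2 ≠ 0) ∧
      (fderiv ℝ (v z.1) z.2 (EuclideanSpace.single 2 1) 0 ≠ 0 ∨ fderiv ℝ (v z.1) z.2 (EuclideanSpace.single 2 1) 1 ≠ 0))
    (hpin : ∀ m : ℝ → ℝ, ∀ W₁ : Set (ℝ × EuclideanSpace ℝ (Fin 3)), W₁ ⊆ W → IsOpen W₁ → W₁.Nonempty →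
      ∃ z ∈ W₁, ∃ b : Fin 3, b ≠ 2 ∧
        fderiv ℝ (v z.1) z.2 (EuclideanSpace.single 2 1) b ≠
          m z.1 * fderiv ℝ (v z.1) z.2 (EuclideanSpace.single b 1) 2)
    (htw : ∀ z ∈ W,
      fderiv ℝ (fun x => fderiv ℝ (v z.1) x (EuclideanSpace.single 2 1) 2) z.2 (EuclideanSpace.single 0 1) *
          fderiv ℝ (v z.1) z.2 (EuclideanSpace.single 1 1) 2 -
        fderiv ℝ (fun x => fderiv ℝ (v z.1) x (EuclideanSpace.single 2 1) 2) z.2 (EuclideanSpace.single 1 1) *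
          fderiv ℝ (v z.1) z.2 (EuclideanSpace.single 0 1) 2 ≠ 0)
    {m : ℝ → ℝ → ℝ} (hm : ∀ z ∈ W, ∀ b : Fin 3, b ≠ 2 →
      fderiv ℝ (v z.1) z.2 (EuclideanSpace.single 2 1) b =
        m z.1 (z.2 2) * fderiv ℝ (v z.1) z.2 (EuclideanSpace.single b 1) 2) :
    ∃ (μ A : ℝ → ℝ → ℝ) (U : Set (ℝ × EuclideanSpace ℝ (Fin 3))) (p₀ : ℝ × EuclideanSpace ℝ (Fin 3)),
      IsOpen U ∧ p₀ ∈ U ∧ U ⊆ W ∧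
      AnalyticOnNhd ℝ (Function.uncurry v) U ∧
      (∀ p ∈ U, AnalyticAt ℝ (Function.uncurry μ) (p.1, p.2 2)) ∧
      (∀ p ∈ U, AnalyticAt ℝ (Function.uncurry A) (p.1, p.2 2)) ∧
      (∀ p ∈ U, fderiv ℝ (v p.1) p.2 (EuclideanSpace.single 0 1) 1 = fderiv ℝ (v p.1) p.2 (EuclideanSpace.single 1 1) 0) ∧
      (∀ p ∈ U, fderiv ℝ (v p.1) p.2 (EuclideanSpace.single 0 1) 0 + fderiv ℝ (v p.1) p.2 (EuclideanSpace.single 1 1) 1 +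
        fderiv ℝ (v p.1) p.2 (EuclideanSpace.single 2 1) 2 = 0) ∧
      (∀ p ∈ U, ∀ b : Fin 3, b ≠ 2 →
        fderiv ℝ (v p.1) p.2 (EuclideanSpace.single 2 1) b =
          μ p.1 (p.2 2) * fderiv ℝ (v p.1) p.2 (EuclideanSpace.single b 1) 2) ∧
      (∀ p ∈ U,
        (1 - μ p.1 (p.2 2)) *
            (deriv (fun s => v s p.2 2) p.1 + fderiv ℝ (fun y => v p.1 y 2) p.2 (v p.1 p.2)
              - Δ (fun y => v p.1 y 2) p.2) =
          A p.1 (p.2 2) + (deriv (fun s => μ s (p.2 2)) p.1 - deriv (deriv (μ p.1)) (p.2 2)) * v p.1 p.2 2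
            + deriv (μ p.1) (p.2 2) / 2 * v p.1 p.2 2 ^ 2
            - 2 * deriv (μ p.1) (p.2 2) * fderiv ℝ (v p.1) p.2 (EuclideanSpace.single 2 1) 2) ∧
      fderiv ℝ (fun y => fderiv ℝ (v p₀.1) y (EuclideanSpace.single 2 1) 2) p₀.2 (EuclideanSpace.single 0 1) *
            fderiv ℝ (v p₀.1) p₀.2 (EuclideanSpace.single 1 1) 2 -
          fderiv ℝ (fun y => fderiv ℝ (v p₀.1) y (EuclideanSpace.single 2 1) 2) p₀.2 (EuclideanSpace.single 1 1) *
            fderiv ℝ (v p₀.1) p₀.2 (EuclideanSpace.single 0 1) 2 ≠ 0 ∧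
      μ p₀.1 (p₀.2 2) ≠ 0 ∧ μ p₀.1 (p₀.2 2) ≠ 1 ∧ deriv (μ p₀.1) (p₀.2 2) ≠ 0 ∧
      (∀ p ∈ U, A p.1 (p.2 2) = 0) := by
  obtain ⟨μ, A, U, p₀, hU, hp₀, hUW, hvU, hμU, hAU, hpolU, hdivU, hshU, hEU, htwU, hμ0, hμ1, hμz⟩ :=
    exists_localTHDatum hrate hcont hmild hdiv hpol hW hWne hWs hnd hpin htw hm
  obtain ⟨t₀, x₀⟩ := p₀
  -- a product neighbourhood `(t₀ − r, t₀ + r) × B(x₀, r) ⊆ U`, with times `< 0`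
  have ht₀ : t₀ < 0 := (mem_prod.1 (hWs (hUW hp₀))).1
  obtain ⟨r₁, hr₁, hball⟩ := Metric.isOpen_iff.1 hU (t₀, x₀) hp₀
  set r : ℝ := min (r₁ / 2) (-t₀) with hr
  have hr0 : 0 < r := lt_min (half_pos hr₁) (neg_pos.2 ht₀)
  have hrr₁ : r ≤ r₁ / 2 := min_le_left _ _
  have hrt₀ : r ≤ -t₀ := min_le_right _ _
  have hprod : ∀ (s : ℝ) (x : EuclideanSpace ℝ (Fin 3)), |s - t₀| < r → dist x x₀ < r →
      ((s, x) : ℝ × EuclideanSpace ℝ (Fin 3)) ∈ U := by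
    intro s x hs hx
    apply hball
    rw [Metric.mem_ball, Prod.dist_eq, max_lt_iff]
    exact ⟨by rw [Real.dist_eq]; linarith, by linarith⟩
  -- the box and its horizontal slab
  set z₀ : ℝ := x₀ 2 with hz₀
  have hbox : ∀ q ∈ Ioo (t₀ - r) (t₀ + r) ×ˢ Ioo (z₀ - r) (z₀ + r),
      ((q.1, x₀ + (q.2 - z₀) • EuclideanSpace.single 2 1) : ℝ × EuclideanSpace ℝ (Fin 3)) ∈ U ∧
        ((x₀ + (q.2 - z₀) • EuclideanSpace.single 2 (1 : ℝ) : EuclideanSpace ℝ (Fin 3)) 2 = q.2) := by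
    intro q hq
    obtain ⟨hq1, hq2⟩ := mem_prod.1 hq
    refine ⟨hprod _ _ (abs_sub_lt_iff.2 ⟨by linarith [hq1.2], by linarith [hq1.1]⟩) ?_, ?_⟩
    · rw [dist_eq_norm, add_sub_cancel_left, norm_smul, Real.norm_eq_abs]
      have : ‖(EuclideanSpace.single 2 (1 : ℝ) : EuclideanSpace ℝ (Fin 3))‖ = 1 := by simp
      rw [this, mul_one]
      exact abs_sub_lt_iff.2 ⟨by linarith [hq2.2], by linarith [hq2.1]⟩
    · have h2 : ((x₀ + (q.2 - z₀) • EuclideanSpace.single 2 (1 : ℝ) : EuclideanSpace ℝ (Fin 3)) 2) = x₀ 2 + (q.2 - z₀) := by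
        simp
      rw [h2, ← hz₀]; ring
  have hμbox : ∀ q ∈ Ioo (t₀ - r) (t₀ + r) ×ˢ Ioo (z₀ - r) (z₀ + r), AnalyticAt ℝ (uncurry μ) q := by
    intro q hq
    obtain ⟨hmem, h2⟩ := hbox q hq
    have h := hμU _ hmem
    dsimp only at h
    rwa [h2] at h
  have hAbox : ∀ q ∈ Ioo (t₀ - r) (t₀ + r) ×ˢ Ioo (z₀ - r) (z₀ + r), AnalyticAt ℝ (uncurry A) q := by
    intro q hq
    obtain ⟨hmem, h2⟩ := hbox q hq
    have h := hAU _ hmem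
    dsimp only at h
    rwa [h2] at h
  set S : Set (ℝ × EuclideanSpace ℝ (Fin 3)) :=
    Ioo (t₀ - r) (t₀ + r) ×ˢ {x : EuclideanSpace ℝ (Fin 3) | z₀ - r < x 2 ∧ x 2 < z₀ + r} with hS
  have hSo : IsOpen S := isOpen_hslab _ _ _ _
  have hSc : IsPreconnected S := isPreconnected_hslab _ _ _ _
  have hS0 : S ⊆ Iio (0 : ℝ) ×ˢ univ := fun p hp => mk_mem_prod (by have := (mem_prod.1 hp).1.2; exact lt_of_lt_of_le this (by linarith)) (mem_univ _)
  have hvS : AnalyticOnNhd ℝ (uncurry v) S :=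
    (analyticOnNhd_uncurry hcont (bdd_of_hasTypeITimeDecay hrate) hmild).mono hS0
  have hμS : ∀ p ∈ S, AnalyticAt ℝ (uncurry μ) (p.1, p.2 2) := analyticAt_shadow_of_box hμbox
  have hAS : ∀ p ∈ S, AnalyticAt ℝ (uncurry A) (p.1, p.2 2) := analyticAt_shadow_of_box hAbox
  -- the shrunken window
  set U' : Set (ℝ × EuclideanSpace ℝ (Fin 3)) := U ∩ S with hU'
  have hU'o : IsOpen U' := hU.inter hSo
  have hp₀S : ((t₀, x₀) : ℝ × EuclideanSpace ℝ (Fin 3)) ∈ S :=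
    mk_mem_prod ⟨by linarith, by linarith⟩ ⟨by rw [← hz₀]; linarith, by rw [← hz₀]; linarith⟩
  have hp₀' : ((t₀, x₀) : ℝ × EuclideanSpace ℝ (Fin 3)) ∈ U' := ⟨hp₀, hp₀S⟩
  -- E on the whole slab, then `A ≡ 0` on the box
  have hES := eLaw_on_of_germ hSo hSc hvS hμS hAS hU'o ⟨_, hp₀'⟩ inter_subset_right fun p hp => hEU p hp.1
  have hA0 := pressureDatum_eq_zero hrate hcont hmild hdiv hK0 hK (by linarith : t₀ + r ≤ 0) hμbox hAbox hES
  refine ⟨μ, A, U', (t₀, x₀), hU'o, hp₀', inter_subset_left.trans hUW, hvU.mono inter_subset_left,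
    fun p hp => hμU p hp.1, fun p hp => hAU p hp.1, fun p hp => hpolU p hp.1, fun p hp => hdivU p hp.1,
    fun p hp => hshU p hp.1, fun p hp => hEU p hp.1, htwU, hμ0, hμ1, hμz, fun p hp => ?_⟩
  have hpS := (mem_prod.1 hp.2)
  exact hA0 (p.1, p.2 2) (mk_mem_prod hpS.1 hpS.2)

end Summit.NavierStokesRegularity.NavierStokesRegularity.Theorems.PoloidalWindowDoorPoloidalWindowRigiditySparseEnergySourceFreeDatum

end
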